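import Summits.AtomisticToContinuum.HydrodynamicLimit.Theorems.InformationPercolationEngineChaosClosesEulerShellTime
import Summits.AtomisticToContinuum.HydrodynamicLimit.Theorems.InformationPercolationEngineChaosClosesEulerReductionEuler
import HarnessLib

/-!
# BF18 shell for functions (crux `ChaosClosesEuler`, stmt-AtomisticToContinuum-15141, line `Sketch`,
# stub `stub_bf18Shell`) — helper: glue for the final assembly (`stub_bf18ShellGlue`)

WHAT. Two glue facts for the final assembly of the deterministic BF18 relative-energy shell of the line.

(G1) **Expansion of the windowed entropy input (H3).** The clamped local second law reaches the shell tested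
against `θ̃(s, x) cut(s)`, `cut(s) = ζ((τ₀ + Δ − s)/Δ)` the smooth decreasing time cut-off
(`ζ = Real.smoothTransition`) with weight `w = −cut'`. By the one-sided product rule in time on `[0, T)` and
`∇(θ̃ cut) = cut ∇θ̃`, pointwise on `[0, T) × 𝕋³` and for ARBITRARY fields `q, Z : ℝ → 𝕋³ → ℝ`,
`m : ℝ → 𝕋³ → ℝ³` (the lead instantiates `q = ϱ`, `Z = Z(V)` the clamped entropy, `m` the momentum):
`q Z ∂ₜ(θ̃ cut) + Z ⟪m, ∇(θ̃ cut)⟫ = cut · (q Z ∂ₜθ̃ + Z ⟪m, ∇θ̃⟫) − w · θ̃ q Z` (`pointwise_expansion`).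
Integrated over `[0, t] × 𝕋³`, `t < T`, with `cut(0) = 1` (`0 ≤ τ₀`, `Δ > 0`) and under `x`-integrability of
the two slices and `s`-integrability of their `x`-integrals `GS(s) = ∫ (q Z ∂ₜθ̃ + Z ⟪m, ∇θ̃⟫)(s, ·)`,
`XS(s) = ∫ (θ̃ q Z)(s, ·)`:
`∫_{[0,t]} ∫ (…) ds + ∫ q₀ Z₀ θ̃₀ cut(0) = ∫_{[0,t]} cut · GS − ∫_{[0,t]} w · XS + XS(0)` (`integral_expansion`),
hence (H3) `… ≤ δ` reads `∫ cut · GS − ∫ w · XS + XS(0) ≤ δ` (`windowed_entropy_le`).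

(G2) **Mass conservation from (H1)** (the registered statement `stub_bf18ShellGlue`): the continuity
hypothesis of the shell, valid for all `C¹` space–time tests, applied to the constant test `φ ≡ 1` (whose time
derivative and partial derivatives vanish) gives `∫ ϱ(τ) = ∫ ϱ(0)` for every `τ ∈ [0, t]`.

WHY. (G1) converts the tested entropy input into the form `X0 + ∫ cut · G − ∫ w · X` consumed by the
weighted-in-time bookkeeping (`ChaosClosesEulerShellTime`) and the windowed Grönwall step of the assembly;
(G2) is the mass normalisation of the relative energy at all times of `[0, t]`.

No named fact is invoked.
-/

noncomputable section

namespace Summit.AtomisticToContinuum.HydrodynamicLimit.Theorems.ChaosClosesEulerShellGlue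

open Set MeasureTheory Literature.Analysis.FunctionSpaces
open scoped InnerProductSpace
open Literature.MathematicalPhysics.KineticTheory (T3 V3)
open Summit.AtomisticToContinuum.HydrodynamicLimit.Theorems.ChaosClosesEulerReduction
  (timeDerivWithin_mul_cut gradient_mul_const isContDiff_one_slice cut_eq_one)
open Summit.AtomisticToContinuum.HydrodynamicLimit.Theorems.ChaosClosesEulerShellTime
  (hasDerivAt_cut_deriv integrableOn_cut_mul integrableOn_weight_mul)

variable {T : ℝ} {θ : ℝ → T3 → ℝ}

/-! ## §1 (G1) Expansion of the windowed entropy input (H3) -/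

/-- **(G1, pointwise) expansion of the tested entropy integrand.** For `θ` smooth on `[0, T) × 𝕋³`,
`s ∈ [0, T)` and arbitrary fields `q, Z, m`: with `cut(s) = ζ((τ₀ + Δ − s)/Δ)`,
`q Z ∂ₜ(θ cut) + Z ⟪m, ∇(θ cut)⟫ = cut · (q Z ∂ₜθ + Z ⟪m, ∇θ⟫) − (−cut') · (θ q Z)` at `(s, x)`
(one-sided product rule within `[0, T)`, `∇(θ(s, ·) cut(s)) = cut(s) ∇θ(s, ·)`). [folklore] -/
theorem pointwise_expansion (hθ : Torus.IsSmoothSpaceTimeOn (Ico 0 T) θ) (τ₀ Δ : ℝ)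
    (q Zf : ℝ → T3 → ℝ) (mf : ℝ → T3 → V3) {s : ℝ} (hs : s ∈ Ico 0 T) (x : T3) :
    q s x * Zf s x * Torus.timeDerivWithin (Ico 0 T)
        (fun s' y => θ s' y * Real.smoothTransition ((τ₀ + Δ - s') / Δ)) s x +
      Zf s x * ⟪mf s x, Torus.gradient (fun y => θ s y * Real.smoothTransition ((τ₀ + Δ - s) / Δ)) x⟫_ℝ =
    Real.smoothTransition ((τ₀ + Δ - s) / Δ) *
        (q s x * Zf s x * Torus.timeDerivWithin (Ico 0 T) θ s x + Zf s x * ⟪mf s x, Torus.gradient (θ s) x⟫_ℝ) -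
      -deriv (fun s' => Real.smoothTransition ((τ₀ + Δ - s') / Δ)) s * (θ s x * (q s x * Zf s x)) := by
  rw [timeDerivWithin_mul_cut hθ (hasDerivAt_cut_deriv τ₀ Δ s) hs x,
    gradient_mul_const (isContDiff_one_slice hθ hs) _ x, real_inner_smul_right]
  ring

/-- **(G1, sliced) the `x`-integral of the tested entropy integrand at a time `s ∈ [0, T)`** is
`cut(s) GS(s) − w(s) XS(s)` when the two slices `q Z ∂ₜθ + Z ⟪m, ∇θ⟫` and `θ q Z` are `x`-integrable. [folklore] -/
theorem slice_expansion (hθ : Torus.IsSmoothSpaceTimeOn (Ico 0 T) θ) (τ₀ Δ : ℝ)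
    (q Zf : ℝ → T3 → ℝ) (mf : ℝ → T3 → V3) {s : ℝ} (hs : s ∈ Ico 0 T)
    (hg : Integrable fun x =>
      q s x * Zf s x * Torus.timeDerivWithin (Ico 0 T) θ s x + Zf s x * ⟪mf s x, Torus.gradient (θ s) x⟫_ℝ)
    (hk : Integrable fun x => θ s x * (q s x * Zf s x)) :
    ∫ x, (q s x * Zf s x * Torus.timeDerivWithin (Ico 0 T)
        (fun s' y => θ s' y * Real.smoothTransition ((τ₀ + Δ - s') / Δ)) s x +
      Zf s x * ⟪mf s x, Torus.gradient (fun y => θ s y * Real.smoothTransition ((τ₀ + Δ - s) / Δ)) x⟫_ℝ) =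
    Real.smoothTransition ((τ₀ + Δ - s) / Δ) *
        (∫ x, (q s x * Zf s x * Torus.timeDerivWithin (Ico 0 T) θ s x +
          Zf s x * ⟪mf s x, Torus.gradient (θ s) x⟫_ℝ)) -
      -deriv (fun s' => Real.smoothTransition ((τ₀ + Δ - s') / Δ)) s *
        ∫ x, θ s x * (q s x * Zf s x) := by
  have hpt : (fun x => q s x * Zf s x * Torus.timeDerivWithin (Ico 0 T)
        (fun s' y => θ s' y * Real.smoothTransition ((τ₀ + Δ - s') / Δ)) s x +
      Zf s x * ⟪mf s x, Torus.gradient (fun y => θ s y * Real.smoothTransition ((τ₀ + Δ - s) / Δ)) x⟫_ℝ) =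
      fun x => Real.smoothTransition ((τ₀ + Δ - s) / Δ) *
          (q s x * Zf s x * Torus.timeDerivWithin (Ico 0 T) θ s x + Zf s x * ⟪mf s x, Torus.gradient (θ s) x⟫_ℝ) -
        -deriv (fun s' => Real.smoothTransition ((τ₀ + Δ - s') / Δ)) s * (θ s x * (q s x * Zf s x)) :=
    funext fun x => pointwise_expansion hθ τ₀ Δ q Zf mf hs x
  rw [hpt, integral_sub (hg.const_mul _) (hk.const_mul _), integral_const_mul, integral_const_mul]

/-- **(G1, integrated) expansion of the windowed entropy input.** For `θ` smooth on `[0, T) × 𝕋³`, `t < T`,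
`Δ > 0`, `0 ≤ τ₀` (so `cut(0) = 1`), arbitrary fields `q, Z, m` whose slices `q Z ∂ₜθ + Z ⟪m, ∇θ⟫` and `θ q Z`
are `x`-integrable at every `s ∈ [0, t]` with `x`-integrals `GS`, `XS` integrable on `[0, t]`:
`∫_{[0,t]} ∫ (q Z ∂ₜ(θ cut) + Z ⟪m, ∇(θ cut)⟫) + ∫ q₀ Z₀ (θ₀ cut(0)) = ∫_{[0,t]} cut · GS − ∫_{[0,t]} w · XS + XS(0)`,
`w = −cut'`. [folklore] -/
theorem integral_expansion (hθ : Torus.IsSmoothSpaceTimeOn (Ico 0 T) θ) {t τ₀ Δ : ℝ} (ht : t < T)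
    (hΔ : 0 < Δ) (hτ₀ : 0 ≤ τ₀) (q Zf : ℝ → T3 → ℝ) (mf : ℝ → T3 → V3)
    (hg : ∀ s ∈ Icc 0 t, Integrable fun x =>
      q s x * Zf s x * Torus.timeDerivWithin (Ico 0 T) θ s x + Zf s x * ⟪mf s x, Torus.gradient (θ s) x⟫_ℝ)
    (hk : ∀ s ∈ Icc 0 t, Integrable fun x => θ s x * (q s x * Zf s x))
    (hGS : IntegrableOn (fun s => ∫ x, (q s x * Zf s x * Torus.timeDerivWithin (Ico 0 T) θ s x +
      Zf s x * ⟪mf s x, Torus.gradient (θ s) x⟫_ℝ)) (Icc 0 t))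
    (hXS : IntegrableOn (fun s => ∫ x, θ s x * (q s x * Zf s x)) (Icc 0 t)) :
    (∫ s in Icc 0 t, ∫ x, (q s x * Zf s x * Torus.timeDerivWithin (Ico 0 T)
        (fun s' y => θ s' y * Real.smoothTransition ((τ₀ + Δ - s') / Δ)) s x +
      Zf s x * ⟪mf s x, Torus.gradient (fun y => θ s y * Real.smoothTransition ((τ₀ + Δ - s) / Δ)) x⟫_ℝ)) +
      ∫ x, q 0 x * Zf 0 x * (θ 0 x * Real.smoothTransition ((τ₀ + Δ - 0) / Δ)) =
    (∫ s in Icc 0 t, Real.smoothTransition ((τ₀ + Δ - s) / Δ) *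
        ∫ x, (q s x * Zf s x * Torus.timeDerivWithin (Ico 0 T) θ s x +
          Zf s x * ⟪mf s x, Torus.gradient (θ s) x⟫_ℝ)) -
      (∫ s in Icc 0 t, -deriv (fun s' => Real.smoothTransition ((τ₀ + Δ - s') / Δ)) s *
        ∫ x, θ s x * (q s x * Zf s x)) +
      ∫ x, θ 0 x * (q 0 x * Zf 0 x) := by
  have hIco : ∀ s ∈ Icc (0 : ℝ) t, s ∈ Ico 0 T := fun s hs => ⟨hs.1, hs.2.trans_lt ht⟩
  have h1 : EqOn (fun s => ∫ x, (q s x * Zf s x * Torus.timeDerivWithin (Ico 0 T)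
        (fun s' y => θ s' y * Real.smoothTransition ((τ₀ + Δ - s') / Δ)) s x +
      Zf s x * ⟪mf s x, Torus.gradient (fun y => θ s y * Real.smoothTransition ((τ₀ + Δ - s) / Δ)) x⟫_ℝ))
      (fun s => Real.smoothTransition ((τ₀ + Δ - s) / Δ) *
          (∫ x, (q s x * Zf s x * Torus.timeDerivWithin (Ico 0 T) θ s x +
            Zf s x * ⟪mf s x, Torus.gradient (θ s) x⟫_ℝ)) -
        -deriv (fun s' => Real.smoothTransition ((τ₀ + Δ - s') / Δ)) s *
          ∫ x, θ s x * (q s x * Zf s x)) (Icc 0 t) :=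
    fun s hs => slice_expansion hθ τ₀ Δ q Zf mf (hIco s hs) (hg s hs) (hk s hs)
  have h0 : (fun x => q 0 x * Zf 0 x * (θ 0 x * Real.smoothTransition ((τ₀ + Δ - 0) / Δ))) =
      fun x => θ 0 x * (q 0 x * Zf 0 x) := by
    funext x; rw [cut_eq_one hΔ hτ₀]; ring
  rw [setIntegral_congr_fun measurableSet_Icc h1,
    integral_sub (integrableOn_cut_mul hGS τ₀ Δ) (integrableOn_weight_mul hXS τ₀ Δ), h0]

/-- **(G1, the lead's form) the windowed entropy input (H3) expanded.** Under the hypotheses of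
`integral_expansion`, the tested inequality
`∫_{[0,t]} ∫ (q Z ∂ₜ(θ cut) + Z ⟪m, ∇(θ cut)⟫) + ∫ q₀ Z₀ (θ₀ cut(0)) ≤ δ` is
`∫_{[0,t]} cut · GS − ∫_{[0,t]} w · XS + XS(0) ≤ δ`. [folklore] -/
theorem windowed_entropy_le (hθ : Torus.IsSmoothSpaceTimeOn (Ico 0 T) θ) {t τ₀ Δ δ : ℝ} (ht : t < T)
    (hΔ : 0 < Δ) (hτ₀ : 0 ≤ τ₀) (q Zf : ℝ → T3 → ℝ) (mf : ℝ → T3 → V3)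
    (hg : ∀ s ∈ Icc 0 t, Integrable fun x =>
      q s x * Zf s x * Torus.timeDerivWithin (Ico 0 T) θ s x + Zf s x * ⟪mf s x, Torus.gradient (θ s) x⟫_ℝ)
    (hk : ∀ s ∈ Icc 0 t, Integrable fun x => θ s x * (q s x * Zf s x))
    (hGS : IntegrableOn (fun s => ∫ x, (q s x * Zf s x * Torus.timeDerivWithin (Ico 0 T) θ s x +
      Zf s x * ⟪mf s x, Torus.gradient (θ s) x⟫_ℝ)) (Icc 0 t))
    (hXS : IntegrableOn (fun s => ∫ x, θ s x * (q s x * Zf s x)) (Icc 0 t))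
    (H3 : (∫ s in Icc 0 t, ∫ x, (q s x * Zf s x * Torus.timeDerivWithin (Ico 0 T)
        (fun s' y => θ s' y * Real.smoothTransition ((τ₀ + Δ - s') / Δ)) s x +
      Zf s x * ⟪mf s x, Torus.gradient (fun y => θ s y * Real.smoothTransition ((τ₀ + Δ - s) / Δ)) x⟫_ℝ)) +
      ∫ x, q 0 x * Zf 0 x * (θ 0 x * Real.smoothTransition ((τ₀ + Δ - 0) / Δ)) ≤ δ) :
    (∫ s in Icc 0 t, Real.smoothTransition ((τ₀ + Δ - s) / Δ) *
        ∫ x, (q s x * Zf s x * Torus.timeDerivWithin (Ico 0 T) θ s x +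
          Zf s x * ⟪mf s x, Torus.gradient (θ s) x⟫_ℝ)) -
      (∫ s in Icc 0 t, -deriv (fun s' => Real.smoothTransition ((τ₀ + Δ - s') / Δ)) s *
        ∫ x, θ s x * (q s x * Zf s x)) +
      ∫ x, θ 0 x * (q 0 x * Zf 0 x) ≤ δ := by
  rwa [integral_expansion hθ ht hΔ hτ₀ q Zf mf hg hk hGS hXS] at H3

/-! ## §2 (G2) Mass conservation from the continuity hypothesis (H1): the registered statement -/

/-- REGISTERED SUB-GOAL `stub_bf18ShellGlue` of the line `Sketch` (helper of `stub_bf18Shell`): **mass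
conservation from (H1).** If the continuity law of the field `V = (ϱ, m, E)` holds against every `C¹`
space–time test `φ`, `∫ φ(τ) ϱ(τ) − ∫ φ(0) ϱ(0) = ∫_{[0,τ]} ∫ (∂ₜφ ϱ + m · ∇φ)`, then (test `φ ≡ 1`, whose time
derivative and partial derivatives vanish) `∫ ϱ(τ) = ∫ ϱ(0)` for every `τ ∈ [0, t]`. [folklore] -/
theorem stub_bf18ShellGlue : ∀ (V : ℝ → UnitAddTorus (Fin 3) → ℝ × EuclideanSpace ℝ (Fin 3) × ℝ) (t : ℝ), (∀ φ : ℝ → UnitAddTorus (Fin 3) → ℝ, ContDiff ℝ 1 (Literature.Analysis.FunctionSpaces.Torus.stLift φ) → ∀ τ ∈ Set.Icc 0 t, (∫ x, φ τ x * (V τ x).1) - ∫ x, φ 0 x * (V 0 x).1 = ∫ s in Set.Icc 0 τ, ∫ x, (deriv (fun s' => φ s' x) s * (V s x).1 + ∑ k : Fin 3, (V s x).2.1 k * Literature.Analysis.FunctionSpaces.Torus.partialDeriv k (φ s) x)) → ∀ τ ∈ Set.Icc 0 t, ∫ x, (V τ x).1 = ∫ x, (V 0 x).1 := by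
  intro V t hcont τ hτ
  have hc : ContDiff ℝ 1 (Torus.stLift fun (_ : ℝ) (_ : UnitAddTorus (Fin 3)) => (1 : ℝ)) := contDiff_const
  have hpd : ∀ (k : Fin 3) (x : UnitAddTorus (Fin 3)),
      Torus.partialDeriv k (fun _ : UnitAddTorus (Fin 3) => (1 : ℝ)) x = 0 := fun k x => by
    simp [Torus.partialDeriv, Torus.lineDeriv]
  have h := hcont (fun _ _ => 1) hc τ hτ
  simp only [one_mul, deriv_const, zero_mul, hpd, mul_zero, Finset.sum_const_zero, add_zero,
    integral_zero] at h
  exact sub_eq_zero.1 h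

end Summit.AtomisticToContinuum.HydrodynamicLimit.Theorems.ChaosClosesEulerShellGlue

end
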